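import Mathlib
import HarnessLib
import Summits.QuantumFields.YangMills.Theses.PencilRigidity
import Summits.QuantumFields.YangMills.Theorems.PencilRigidityCurvatureKernelBoundLatticeWindowPairOfOne
import Summits.QuantumFields.YangMills.Theorems.PencilRigidityCurvatureKernelBoundTwoPointLocalBoundScaling

/-!
# `CurvatureKernelBound` — stub J `SmearedOfPointwise` (support for stmt-QuantumFields-11687, line `sixteen-charts-analytic-kernel`, skeleton v15)

Pure bookkeeping, per scheme `(r, sch)` and with no Schwinger family: the one-variable POINTWISE lattice window bound
(E‴₁'s conclusion, `c_k² |Cov_k(Q_0, Q_z)| ≤ C (a_k‖z‖)^(η−10)` for `z ≠ 0` in the box, `R₀ ≤ ‖z‖`, `a_k‖z‖ ≤ θ`, frequently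
in `k`) implies the SMEARED lattice window bound E^sm: frequently in `k`, for all scales `a_k R₀ ≤ s ≤ θ'` and real test
functions `f₀, f₁` supported in `ρ`-balls (`ρ ≤ s/2`) about `∓s e₀`,
`|LS₂(f₀,f₁) − LS₁(f₀) LS₁(f₁)| ≤ C' s^(η−10) R_k(f₀) R_k(f₁)`, `R_k(f) = a_k⁴ Σ_{x ∈ box} |f(a_k x)|`.

Route: `LatticeWindowPairOfOne` (one-variable ⇒ pair form); every contributing pair of lattice points lies in the two balls,
hence its separation is in the window `[s, 3s]` (`TwoPointLocal.norm_sub_mem_window_of_balls`), so the pair bound and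
`LatticeWindow.rpow_window_le` give a per-pair constant `D = C' s^(η−10)` with `C' = max C 0 · (3/2)^η 2¹⁰ · 2^(η−10)`,
`θ' = θ/3`; `LatticeWindow.abs_truncated_le_of_cov_le` turns the per-pair bound into the smeared one. This is exactly the
block `hpair` of `TwoPointLocalBoundScaling`, with the frequently-set kept (no subsequence extraction). [folklore]
-/

noncomputable section

open scoped BigOperators Topology SchwartzMap
open MeasureTheory Filter Set Metric
open Literature.MathematicalPhysics.QuantumLattice Literature.MathematicalPhysics.AQFT
open Literature.MathematicalPhysics.QuantumFieldTheory
open Literature.Probability.LatticeModels (Site box mem_box)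

namespace Summit.QuantumFields.YangMills.Theorems.CurvatureKernel

open LatticeWindow TwoPointLocal in
/-- **Stub J `SmearedOfPointwise`** (registered signature verbatim; skeleton v15 of line `sixteen-charts-analytic-kernel`).
The one-variable pointwise lattice window bound on the renormalised truncated plaquette covariance implies the smeared lattice
window bound `|LS₂(f₀,f₁) − LS₁(f₀)LS₁(f₁)| ≤ C s^(η−10) R_k(f₀) R_k(f₁)` for real test functions supported in `ρ`-balls
(`ρ ≤ s/2`) about `∓s e₀`, frequently in `k`. See the module docstring. [folklore] -/
theorem SmearedOfPointwise : open Literature.MathematicalPhysics.QuantumLattice Literature.MathematicalPhysics.AQFT Literature.MathematicalPhysics.QuantumFieldTheory in ∀ (G : Type) [Group G] [TopologicalSpace G] [IsTopologicalGroup G] [CompactSpace G] [MeasurableSpace G] [BorelSpace G] (r : LatticeRep G) (sch : SpeciesScheme (YMSpecies G)), (∃ (C η θ R₀ : ℝ), 0 < η ∧ 0 < θ ∧ ∃ᶠ k in Filter.atTop, ∀ z : Literature.Probability.LatticeModels.Site 4, z ∈ Literature.Probability.LatticeModels.box 4 (sch.L k) → z ≠ 0 → R₀ ≤ ‖siteToE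 z‖ → sch.a k * ‖siteToE z‖ ≤ θ → (sch.c r.curvature k) ^ 2 * |(∫ U, r.curvature.F (torusLift (sch.side k) U) * r.curvature.F (configShift (-z) (torusLift (sch.side k) U)) ∂(wilsonMeasure r.ρ (sch.β k) : MeasureTheory.Measure (GaugeConfig 4 (sch.side k) G))) - (∫ U, r.curvature.F (torusLift (sch.side k) U) ∂(wilsonMeasure r.ρ (sch.β k) : MeasureTheory.Measure (GaugeConfig 4 (sch.side k) G))) * (∫ U, r.curvature.F (configShift (-z) (torusLift (sch.side k) U)) ∂(wilsonMeasure r.ρ (sch.β k) : MeasureTheory.Measure (GaugeConfig 4 (sch.side k) G)))| ≤ C * (sch.a k * ‖siteToE z‖) ^ (η - 10)) → (∃ (C η θ R₀ : ℝ), 0 < η ∧ 0 < θ ∧ ∃ᶠ k in Filter.atTop, ∀ (s ρ : ℝ), 0 < s → sch.a k * R₀ ≤ s → s ≤ θ → 0 < ρ → ρ ≤ s / 2 → ∀ (f : Fin 2 → SchwartzMap (EuclideanSpace ℝ (Fin 4)) ℝ), tsupport ((f 0 : SchwartzMap (EuclideanSpace ℝ (Fin 4)) ℝ) : (EuclideanSpace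 ℝ (Fin 4)) → ℝ) ⊆ Metric.closedBall (EuclideanSpace.single (0 : Fin 4) (-s)) ρ → tsupport ((f 1 : SchwartzMap (EuclideanSpace ℝ (Fin 4)) ℝ) : (EuclideanSpace ℝ (Fin 4)) → ℝ) ⊆ Metric.closedBall (EuclideanSpace.single (0 : Fin 4) s) ρ → |latticeSchwinger r.ρ sch (fun s => s.F) k 2 (fun _ => r.curvature) f - latticeSchwinger r.ρ sch (fun s => s.F) k 1 (fun _ => r.curvature) (fun _ => f 0) * latticeSchwinger r.ρ sch (fun s => s.F) k 1 (fun _ => r.curvature) (fun _ => f 1)| ≤ C * s ^ (η - 10) * ((sch.a k) ^ 4 * ∑ x ∈ Literature.Probability.LatticeModels.box 4 (sch.L k), |f 0 (sch.a k • siteToE x)|) * ((sch.a k) ^ 4 * ∑ x ∈ Literature.Probability.LatticeModels.box 4 (sch.L k), |f 1 (sch.a k • siteToE x)|)) := by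
  intro G _ _ _ _ _ _ r sch hone
  obtain ⟨C, η, θ, R₀, hη, hθ, hfreq⟩ := LatticeWindowPairOfOne G r sch hone
  -- constants
  obtain ⟨Cp, hCCp, hCpnn⟩ : ∃ Cp : ℝ, C ≤ Cp ∧ 0 ≤ Cp := ⟨max C 0, le_max_left _ _, le_max_right _ _⟩
  obtain ⟨Q, hQ, hQnn⟩ : ∃ Q : ℝ, Q = Cp * ((3 / 2) ^ η * 2 ^ (10 : ℝ)) * 2 ^ (η - 10) ∧ 0 ≤ Q :=
    ⟨_, rfl, by positivity⟩
  refine ⟨Q, η, θ / 3, R₀, hη, by positivity, ?_⟩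
  refine hfreq.mono ?_
  intro k hk s ρ hs hsR hsθ _ hρs f hsupp₀ hsupp₁
  have hak : 0 < sch.a k := sch.a_pos k
  have hsθ3 : 3 * s ≤ θ := by linarith
  -- the per-pair constant on the window `[s, 3s]`
  obtain ⟨D, hDdef, hDnn⟩ : ∃ D : ℝ, D = Q * s ^ (η - 10) ∧ 0 ≤ D := ⟨_, rfl, by positivity⟩
  -- the per-pair bound for contributing pairs
  have hpair : ∀ x ∈ box 4 (sch.L k), ∀ y ∈ box 4 (sch.L k),
      f 0 (sch.a k • siteToE x) ≠ 0 → f 1 (sch.a k • siteToE y) ≠ 0 →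
        (sch.c r.curvature k) ^ 2 *
          |(∫ U, r.curvature.F (configShift (-x) (torusLift (sch.side k) U)) *
              r.curvature.F (configShift (-y) (torusLift (sch.side k) U))
              ∂(wilsonMeasure r.ρ (sch.β k) : MeasureTheory.Measure (GaugeConfig 4 (sch.side k) G))) -
            (∫ U, r.curvature.F (configShift (-x) (torusLift (sch.side k) U))
              ∂(wilsonMeasure r.ρ (sch.β k) : MeasureTheory.Measure (GaugeConfig 4 (sch.side k) G))) *
            (∫ U, r.curvature.F (configShift (-y) (torusLift (sch.side k) U))
              ∂(wilsonMeasure r.ρ (sch.β k) : MeasureTheory.Measure (GaugeConfig 4 (sch.side k) G)))| ≤ D := by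
    intro x hx y hy h0 h1
    have hu : sch.a k • siteToE x ∈
        Metric.closedBall (EuclideanSpace.single (0 : Fin 4) (-s) : EuclideanSpace ℝ (Fin 4)) ρ :=
      hsupp₀ (subset_tsupport _ h0)
    have hv : sch.a k • siteToE y ∈
        Metric.closedBall (EuclideanSpace.single (0 : Fin 4) s : EuclideanSpace ℝ (Fin 4)) ρ :=
      hsupp₁ (subset_tsupport _ h1)
    obtain ⟨hw1, hw2⟩ := norm_sub_mem_window_of_balls hs hρs hu hv
    rw [← smul_sub, norm_smul, Real.norm_of_nonneg hak.le] at hw1 hw2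
    -- the pair lies in the window
    have hR : R₀ ≤ ‖siteToE x - siteToE y‖ := by
      by_contra hlt
      have hlt' : ‖siteToE x - siteToE y‖ < R₀ := lt_of_not_ge hlt
      have : sch.a k * ‖siteToE x - siteToE y‖ < sch.a k * R₀ := mul_lt_mul_of_pos_left hlt' hak
      linarith
    have hθ' : sch.a k * ‖siteToE x - siteToE y‖ ≤ θ := by linarith
    have hwin := hk x y hx hy hR hθ'
    refine hwin.trans ?_
    have htpos : 0 < sch.a k * ‖siteToE x - siteToE y‖ := by linarith
    have hpow := rpow_window_le hη (by positivity : 0 < 2 * s)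
      (by linarith : 2 * s / 2 ≤ sch.a k * ‖siteToE x - siteToE y‖)
      (by linarith : sch.a k * ‖siteToE x - siteToE y‖ ≤ 3 * (2 * s) / 2)
    have h2s : (2 * s) ^ (η - 10) = 2 ^ (η - 10) * s ^ (η - 10) := Real.mul_rpow zero_le_two hs.le
    calc C * (sch.a k * ‖siteToE x - siteToE y‖) ^ (η - 10)
        ≤ Cp * (sch.a k * ‖siteToE x - siteToE y‖) ^ (η - 10) :=
          mul_le_mul_of_nonneg_right hCCp (Real.rpow_nonneg htpos.le _)
      _ ≤ Cp * ((3 / 2) ^ η * 2 ^ (10 : ℝ) * (2 * s) ^ (η - 10)) := mul_le_mul_of_nonneg_left hpow hCpnn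
      _ = D := by rw [hDdef, hQ, h2s]; ring
  have hL := abs_truncated_le_of_cov_le r sch r.curvature k f hpair
  rw [hDdef] at hL
  exact hL

end Summit.QuantumFields.YangMills.Theorems.CurvatureKernel

end
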